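import Summits.NavierStokesRegularity.NavierStokesRegularity.Theses.PlaneEnergyCeiling
import HarnessLib

/-!
# Sketch — crux ideas for `PlaneEnergyCeiling.PlanarEnergyAPriori` (stmt-NavierStokesRegularity-16855)

Ideator 1, round 1.  First lemmas of the two idea cards, typed over existing declarations, plus the
kernel-checked compositions showing how each line reaches the crux BY NAME.  Nothing here is a
registered skeleton.
-/

set_option linter.dupNamespace false

noncomputable section

namespace Summit.NavierStokesRegularity.NavierStokesRegularity.Cruxes.PlanarEnergyAPriori.Ideas

open scoped ENNReal
open MeasureTheory

local notation "E3" => EuclideanSpace ℝ (Fin 3)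
local notation "E2" => EuclideanSpace ℝ (Fin 2)

/-- The route's plane parametrisation: the point of the plane `R({x₂ = c})` above `y ∈ ℝ²`. -/
def planePt (R : E3 ≃ₗᵢ[ℝ] E3) (y : E2) (c : ℝ) : E3 := R (WithLp.toLp 2 ![y 0, y 1, c])

/-- Planar kinetic energy of a slice `w` through the plane `R({x₂ = c})` (the crux's integrand). -/
def planarEnergy (w : E3 → E3) (R : E3 ≃ₗᵢ[ℝ] E3) (c : ℝ) : ℝ≥0∞ :=
  ∫⁻ y : E2, ‖w (planePt R y c)‖ₑ ^ 2

/-- Hardy (Newtonian-potential) energy of a slice `w` at the centre `x₀`: `∫ |w|² / |y − x₀|`. -/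
def hardyEnergy (w : E3 → E3) (x₀ : E3) : ℝ≥0∞ :=
  ∫⁻ y : E3, ‖w y‖ₑ ^ 2 / ‖y - x₀‖ₑ

/-! ## Card 1 — `hardy-average-transfer` -/

/-- **First lemma (kinematic, provable now): a planar ceiling is a Hardy ceiling.**
The Hardy energy at `x₀` is twice the AVERAGE over directions of the planar energies of the planes
through `x₀` (`∫_{S²} E(Π_n(x₀)) dσ(n) = 2π ∫ |w|²/|y−x₀| dy`, coarea over the pencil of planes
through `x₀`), hence `sup_{x₀} ∫|w|²/|y−x₀| ≤ 2 · sup_{R,c} E(w;R,c)`. -/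
def PlanarCeilingImpliesHardy : Prop :=
  ∀ (w : E3 → E3), Continuous w → ∀ M : ℝ, 0 ≤ M →
    (∀ (R : E3 ≃ₗᵢ[ℝ] E3) (c : ℝ), planarEnergy w R c ≤ ENNReal.ofReal M) →
    ∀ x₀ : E3, hardyEnergy w x₀ ≤ ENNReal.ofReal (2 * M)

/-- **Open stub A (shared with route HardyPointSink, global parent of its crux `HardyEnergyBound`,
stmt-7979): GLOBAL HARDY CEILING** along every classical Leray–Hopf solution from a rapidly
decaying datum on `[0,T)`: `sup_{t<T} sup_{x₀} ∫ |u(t,y)|²/|y−x₀| dy < ∞`.  Enemy: the `|y−x₀|⁻¹`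
tail (scarred Type I / DSS / RSS blow-up, log-divergent) and Type II in the scaled-energy sense;
blind to energy SHEETS.  Tool: the point-sink balance law `HardyBalanceLaw` (stmt-8388, PROVED). -/
def GlobalHardyCeiling : Prop :=
  ∀ (ν T : ℝ), 0 < ν → 0 < T → ∀ (u : ℝ → E3 → E3) (p : ℝ → E3 → ℝ),
    Literature.Analysis.FluidPDE.IsClassicalNSSolutionOn (Set.Ico 0 T) ν 0 u p →
    Literature.Analysis.FluidPDE.IsLerayHopfOn T ν 0 (u 0) u →
    Literature.Analysis.FluidPDE.HasRapidSpatialDecay (u 0) →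
    ∃ K : ℝ, ∀ t ∈ Set.Ico 0 T, ∀ x₀ : E3, hardyEnergy (u t) x₀ ≤ ENNReal.ofReal K

/-- **Open stub B (the planar-specific residue): NO ENERGY SHEETS — planar energy is bounded along
the solution once the Hardy energies are.**  Under a Hardy ceiling `K`, a planar quantum `q` on an
in-plane disc of radius `ρ` forces a coin of thickness `h ≤ πKρ/q` (flatness), dissipating at rate
`≥ ν q²/(Kρ)`; the statement says such sheets cannot be driven to `q → ∞` before `T`.  Enemy: thin
intense jet/shear layers fed by colliding streams (the census's 1-D (N1) window). -/
def PlanarFromHardy : Prop :=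
  ∀ (ν T : ℝ), 0 < ν → 0 < T → ∀ (u : ℝ → E3 → E3) (p : ℝ → E3 → ℝ),
    Literature.Analysis.FluidPDE.IsClassicalNSSolutionOn (Set.Ico 0 T) ν 0 u p →
    Literature.Analysis.FluidPDE.IsLerayHopfOn T ν 0 (u 0) u →
    Literature.Analysis.FluidPDE.HasRapidSpatialDecay (u 0) →
    (∃ K : ℝ, ∀ t ∈ Set.Ico 0 T, ∀ x₀ : E3, hardyEnergy (u t) x₀ ≤ ENNReal.ofReal K) →
    ∃ M : ℝ, ∀ t ∈ Set.Ico 0 T, ∀ (R : E3 ≃ₗᵢ[ℝ] E3) (c : ℝ),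
      planarEnergy (u t) R c ≤ ENNReal.ofReal M

/-- Composition of the card-1 line: the two open stubs give the crux BY NAME (definitional
unfolding of `planarEnergy`/`planePt` only). -/
theorem planarEnergyAPriori_of_hardy_and_sheets (hA : GlobalHardyCeiling) (hB : PlanarFromHardy) :
    Summit.NavierStokesRegularity.NavierStokesRegularity.Theses.PlaneEnergyCeiling.PlanarEnergyAPriori := by
  intro ν T hν hT u p hcl hLH hdec
  obtain ⟨M, hM⟩ := hB ν T hν hT u p hcl hLH hdec (hA ν T hν hT u p hcl hLH hdec)
  exact ⟨M, fun t ht R c => hM t ht R c⟩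

/-- Converse direction (calibration): the crux implies the global Hardy ceiling, given the
kinematic first lemma and continuity of the slices of a classical solution. -/
theorem globalHardyCeiling_of_crux (hK : PlanarCeilingImpliesHardy)
    (hcont : ∀ (ν T : ℝ) (u : ℝ → E3 → E3) (p : ℝ → E3 → ℝ),
      Literature.Analysis.FluidPDE.IsClassicalNSSolutionOn (Set.Ico 0 T) ν 0 u p →
      ∀ t ∈ Set.Ico 0 T, Continuous (u t))
    (hcrux : Summit.NavierStokesRegularity.NavierStokesRegularity.Theses.PlaneEnergyCeiling.PlanarEnergyAPriori) :
    GlobalHardyCeiling := by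
  intro ν T hν hT u p hcl hLH hdec
  obtain ⟨M, hM⟩ := hcrux ν T hν hT u p hcl hLH hdec
  refine ⟨2 * max M 0, fun t ht x₀ => ?_⟩
  have hM' : ∀ (R : E3 ≃ₗᵢ[ℝ] E3) (c : ℝ), planarEnergy (u t) R c ≤ ENNReal.ofReal (max M 0) :=
    fun R c => (hM t ht R c).trans (ENNReal.ofReal_le_ofReal (le_max_left _ _))
  exact hK (u t) (hcont ν T u p hcl t ht) (max M 0) (le_max_right _ _) hM' x₀

/-! ## Card 2 — `circulation-log-capacity` -/

/-- **First lemma (kinematic, provable now): PLANAR HELMHOLTZ / LOG-CAPACITY IDENTITY.**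
For a smooth rapidly decaying divergence-free `u` on `ℝ³` and the coordinate plane `{x₂ = c}`,
the in-plane part of the planar energy is the 2-D logarithmic (Coulomb) energy of the two neutral
traces `ω_n = ∂₀u₁ − ∂₁u₀` (normal vorticity) and `θ = ∂₂u₂ = −div_∥ u_∥` (normal strain):
`∫_Π (u₀² + u₁²) dA = (1/2π) ∬ [ω_n(y)ω_n(y') + θ(y)θ(y')] log(1/|y−y'|) dA dA'`
(Hodge decomposition `u_∥ = ∇φ + ∇^⊥ψ` on `ℝ²`, `Δφ = −θ`... `Δψ = ω_n`, cross term vanishes,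
`∫|∇ψ|² = −∫ψ ω_n` with the `(1/2π) log` kernel; neutrality `∫_Π ω_n = ∫_Π θ = 0` makes both
energies finite).  The remaining piece of `E` is the normal-jet energy `∫_Π u₂² = −∫_Π p`. -/
def PlanarHelmholtzLogIdentity : Prop :=
  ∀ (u : E3 → E3), ContDiff ℝ (⊤ : ℕ∞) u → Literature.Analysis.FluidPDE.HasRapidSpatialDecay u →
    Literature.Analysis.FluidPDE.VectorCalculus.IsDivFree u → ∀ c : ℝ,
    let P : E2 → E3 := fun y => WithLp.toLp 2 ![y 0, y 1, c]
    let D : Fin 3 → E2 → E3 := fun j y => fderiv ℝ u (P y) (EuclideanSpace.single j 1)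
    let ωn : E2 → ℝ := fun y => (D 0 y) 1 - (D 1 y) 0
    let θ : E2 → ℝ := fun y => (D 2 y) 2
    (∫ y : E2, ((u (P y)) 0) ^ 2 + ((u (P y)) 1) ^ 2) =
      (1 / (2 * Real.pi)) *
        ∫ z : E2 × E2, (ωn z.1 * ωn z.2 + θ z.1 * θ z.2) * Real.log (‖z.1 - z.2‖⁻¹)

/-- **Calibration lemma of card 2 (kinematic, provable now): the swirl of a straight tube.**
For the planar, purely swirling field `u = ∇^⊥ψ(x₀,x₁)`-independent-of-`x₂` truncated smoothly,
the identity reduces to the 2-D energy of the vortex; the quantitative form used by the card is the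
log-capacity lower bound: a neutral trace whose positive part has mass `Γ` inside a disc of radius
`δ` and whose negative part lies outside the concentric disc of radius `L ≥ δ` has
`(1/2π)∬ f f' log(1/|y−y'|) ≥ (Γ²/2π) log(L/δ) − C Γ²` (2-D potential theory). Stated abstractly
for compactly supported continuous neutral densities. -/
def LogCapacityLowerBound : Prop :=
  ∃ C : ℝ, ∀ (f : E2 → ℝ), Continuous f → HasCompactSupport f → (∫ y, f y) = 0 →
    ∀ (Γ δ L : ℝ), 0 < δ → δ ≤ L → 0 ≤ Γ →
    (∀ y, 0 < f y → ‖y‖ ≤ δ) → (∀ y, f y < 0 → L ≤ ‖y‖) → (∫ y, max (f y) 0) = Γ →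
    (1 / (2 * Real.pi)) * ∫ z : E2 × E2, f z.1 * f z.2 * Real.log (‖z.1 - z.2‖⁻¹)
      ≥ Γ ^ 2 / (2 * Real.pi) * Real.log (L / δ) - C * Γ ^ 2

/-- **Second identity of card 2 (kinematic, provable now): HALF-SPACE STRAIN-EXCESS MOMENT.**
For a smooth rapidly decaying divergence-free `u` and the plane `{x₂ = c}`, the normal-jet planar
energy equals the distance-weighted integral, over the half-space beyond the plane, of the
strain–enstrophy imbalance density `σ = Σᵢⱼ ∂ᵢuⱼ ∂ⱼuᵢ = |S|² − ½|ω|² = −Δp`: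
`∫_Π u₂² dA = ∫_{x₂ > c} σ(x) (x₂ − c) dx` (from `∂_c² ∫_Π u₂² = ∫_Π σ`, two in-plane integrations
by parts and the null Lagrangian `det ∇_∥u_∥`; decay gives the boundary conditions at `c → +∞`).
Corollary: `∫_{x₂>c} σ (x₂ − c) ≥ 0` on every half-space. -/
def HalfSpaceStrainExcessIdentity : Prop :=
  ∀ (u : E3 → E3), ContDiff ℝ (⊤ : ℕ∞) u → Literature.Analysis.FluidPDE.HasRapidSpatialDecay u →
    Literature.Analysis.FluidPDE.VectorCalculus.IsDivFree u → ∀ c : ℝ,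
    let σ : E3 → ℝ := fun x => ∑ i : Fin 3, ∑ j : Fin 3,
      (fderiv ℝ u x (EuclideanSpace.single i 1)) j * (fderiv ℝ u x (EuclideanSpace.single j 1)) i
    (∫ y : E2, ((u (WithLp.toLp 2 ![y 0, y 1, c])) 2) ^ 2) =
      ∫ x in {x : E3 | c < x 2}, σ x * (x 2 - c)

end Summit.NavierStokesRegularity.NavierStokesRegularity.Cruxes.PlanarEnergyAPriori.Ideas

end
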